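import Summits.QuantumFields.QCD.Theorems.QuarksAsStableActionStableActionBridgeFermionSliceContinuous
import Summits.QuantumFields.QCD.Theorems.QuarksAsStableActionStableActionBridgeFermionSlicePosDef
import HarnessLib

/-!
# Stub `stub_sliceData_continuous` of line `pin-the-infimum` (crux `RobustYangMillsHandover`, item 8892)

E2, layer W3-3 (lead c16, wave 3): continuity of Smit's slice data in the gauge background.
The insertion of a quark bilinear at one time slice of Lüscher's transfer-matrix representation is an
explicit Fock operator built from the slice data of the background `U_t ∈ SU(3)^{Edge 3 S}`:
`A(U)⁻¹ = (sliceMassHop U mq)⁻¹`, `D(U) = sliceDiracKinetic U`, `M_F(U)⁻¹ = (fermionSliceMatrix U mq)⁻¹`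
and `T̂_F(U) = fermionSliceOp U mq` (Smit (6.91)).  To integrate the resulting cyclic supertrace over
the (compact) configuration space every piece must depend continuously on `U` (product topology on
`GaugeConfig 3 S G = Edge 3 S → G`).  For bare masses `m_f > −1` the spin-blind operator `A(U)` and
the one-particle transfer matrix `M_F(U)` are Hermitian positive definite (`sliceMassHop_posDef`,
`fermionSliceMatrix_posDef`), hence `det ≠ 0` for every `U`, and the matrix inverses
`X⁻¹ = (det X)⁻¹ • adj X` are honest inverses, continuous in `U`; everything else is polynomial in the
link entries (`FermionSliceContinuous.*`).
[cite: Luscher1977, pp. 283–292]; [cite: Smit2023, §6.5 (6.87)–(6.91)].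
Pure theorem file (no definitions); helpers in the sub-namespace `StubSliceDataContinuous`.
-/

namespace Summit.QuantumFields.QCD.Cruxes.RobustYangMillsHandover.PinTheInfimum

open scoped ComplexOrder
open Matrix
open Literature.MathematicalPhysics.QuantumLattice Literature.MathematicalPhysics.QuantumFieldTheory
open Summit.QuantumFields.QCD.Cruxes.StableActionBridge.Sketch

namespace StubSliceDataContinuous

variable {Nf S : ℕ} [NeZero S]

/-- For `m_f > −1` the determinant of Smit's one-particle transfer matrix never vanishes:
`M_F(U) = (1 − N)(A⁻¹ ⊗ P⁺ + A ⊗ P⁻)(1 − Nᴴ)` is positive definite (`fermionSliceMatrix_posDef`).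
[cite: Smit2023, §6.5 (6.91)] -/
theorem fermionSliceMatrix_det_ne_zero (U : GaugeConfig 3 S (Matrix.specialUnitaryGroup (Fin 3) ℂ))
    (mq : Fin Nf → ℝ) (hm : ∀ f, -1 < mq f) : (fermionSliceMatrix U mq).det ≠ 0 :=
  (fermionSliceMatrix_posDef Nf S U mq hm).det_pos.ne'

/-- **For `m_f > −1` the inverse `M_F(U)⁻¹` of Smit's one-particle transfer matrix is continuous in the
background `U`**: `M_F⁻¹ = (det M_F)⁻¹ • adj M_F` with `det M_F(U) ≠ 0` everywhere and `M_F(U)` continuous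
(`FermionSliceContinuous.continuous_fermionSliceMatrix`). [folklore] -/
theorem continuous_fermionSliceMatrix_inv (mq : Fin Nf → ℝ) (hm : ∀ f, -1 < mq f) :
    Continuous fun U : GaugeConfig 3 S (Matrix.specialUnitaryGroup (Fin 3) ℂ) =>
      (fermionSliceMatrix U mq)⁻¹ := by
  simp_rw [Matrix.inv_def, Ring.inverse_eq_inv]
  exact ((FermionSliceContinuous.continuous_fermionSliceMatrix mq hm).matrix_det.fun_inv₀ fun U =>
    fermionSliceMatrix_det_ne_zero U mq hm).fun_smul
      (FermionSliceContinuous.continuous_fermionSliceMatrix mq hm).matrix_adjugate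

end StubSliceDataContinuous

/-- **W3-3: continuity of Smit's slice data in the gauge background** (stub `stub_sliceData_continuous`
of line `pin-the-infimum`).  For every number of flavours `N_f`, every spatial torus side `S ≥ 1` and all
bare masses `m_f > −1`, the maps `U ↦ A(U) = sliceMassHop U mq`, `U ↦ A(U)⁻¹`,
`U ↦ D(U) = sliceDiracKinetic U`, `U ↦ M_F(U) = fermionSliceMatrix U mq`, `U ↦ M_F(U)⁻¹` and
`U ↦ T̂_F(U) = fermionSliceOp U mq` are continuous on `SU(3)^{Edge 3 S}` (product topology), and
`det A(U)`, `det M_F(U)` are units for every `U` (both matrices are positive definite).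
The statement is the registered stub signature verbatim.
[cite: Luscher1977, pp. 283–292]; [cite: Smit2023, §6.5 (6.91)] -/
theorem stub_sliceData_continuous :
    ∀ (Nf S : ℕ) [NeZero S] (mq : Fin Nf → ℝ), (∀ f, -1 < mq f) →
      Continuous (fun U : GaugeConfig 3 S (Matrix.specialUnitaryGroup (Fin 3) ℂ) => sliceMassHop U mq) ∧
      Continuous (fun U : GaugeConfig 3 S (Matrix.specialUnitaryGroup (Fin 3) ℂ) => (sliceMassHop U mq)⁻¹) ∧
      Continuous (fun U : GaugeConfig 3 S (Matrix.specialUnitaryGroup (Fin 3) ℂ) => sliceDiracKinetic (Nf := Nf) U) ∧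
      Continuous (fun U : GaugeConfig 3 S (Matrix.specialUnitaryGroup (Fin 3) ℂ) => fermionSliceMatrix U mq) ∧
      Continuous (fun U : GaugeConfig 3 S (Matrix.specialUnitaryGroup (Fin 3) ℂ) => (fermionSliceMatrix U mq)⁻¹) ∧
      Continuous (fun U : GaugeConfig 3 S (Matrix.specialUnitaryGroup (Fin 3) ℂ) => fermionSliceOp U mq) ∧
      (∀ U : GaugeConfig 3 S (Matrix.specialUnitaryGroup (Fin 3) ℂ), IsUnit (sliceMassHop U mq).det ∧ IsUnit (fermionSliceMatrix U mq).det) := by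
  intro Nf S _ mq hm
  refine ⟨FermionSliceContinuous.continuous_sliceMassHop mq,
    FermionSliceContinuous.continuous_sliceMassHop_inv mq hm,
    FermionSliceContinuous.continuous_sliceDiracKinetic,
    FermionSliceContinuous.continuous_fermionSliceMatrix mq hm,
    StubSliceDataContinuous.continuous_fermionSliceMatrix_inv mq hm,
    continuous_fermionSliceOp Nf S mq hm, fun U => ⟨?_, ?_⟩⟩
  · exact isUnit_iff_ne_zero.mpr (FermionSliceContinuous.sliceMassHop_det_ne_zero U mq hm)
  · exact isUnit_iff_ne_zero.mpr (StubSliceDataContinuous.fermionSliceMatrix_det_ne_zero U mq hm)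

end Summit.QuantumFields.QCD.Cruxes.RobustYangMillsHandover.PinTheInfimum
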